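import Literature.Analysis.FluidPDE.TaoH1APriori
import Literature.Analysis.FluidPDE.LerayEnstrophyAPriori
import HarnessLib

/-!
# Discharge of `leray_enstrophy_apriori` (Robinson–Rodrigo–Sadowski 2016, (6.6)–(6.10), Cor. 6.9)

Analysis/FluidPDE proof file for the named facts of `TaoH1APriori.lean` (the a priori leaves of
the decomposition of `tao2011_H1_local_almost_regular`). The enstrophy a priori bound with
lifespan `‖∇u₀‖⁴ T ≤ c ν³`, `leray_enstrophy_apriori`, is **proved** in
`LerayEnstrophyAPriori.lean` (`exists_leray_enstrophy_apriori`: the cubic enstrophy inequality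
with dissipation for classical solutions in the smooth `H¹` class, by viscosity splitting of the
tree's Serrin production bound at `r = 6`, and a continuity argument; constants `c = 1/(8κ)`,
`K = 54`); this file records the discharge. (The second fact of `TaoH1APriori.lean`,
`tao2011_quantitative_regularity` (Tao 2011, Lemma 5.5), is discharged in
`TaoH1APrioriProofs.lean`.)

## References

* J. C. Robinson, J. L. Rodrigo, W. Sadowski, *The Three-Dimensional Navier–Stokes Equations*,
  CUP 2016, proof of Thm. 6.8, (6.6)–(6.10), Cor. 6.9. [RobinsonRodrigoSadowski2016]
* T. Tao, Anal. PDE 6 (2013) = arXiv:1108.1165, Thm. 5.4 (ii). [Tao2011]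
-/

noncomputable section

namespace Literature.Analysis.FluidPDE

/-- **Discharge of `leray_enstrophy_apriori`**: there are absolute constants `c, K > 0` such that
every classical solution of the unforced Navier–Stokes system on `[0, T] × ℝ³` in the smooth `H¹`
class with `∫|∇u(0)|² ≤ A` and `A² T ≤ c ν³` has `∫|∇u(t)|² ≤ K A` on `[0, T]` and
`ν ∫₀ᵀ∫‖D²u‖² ≤ K A` (Robinson–Rodrigo–Sadowski 2016, (6.9)–(6.10), Cor. 6.9) — the theorem
`exists_leray_enstrophy_apriori` of `LerayEnstrophyAPriori.lean`, whose statement is the body of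
the named fact. [cite: RobinsonRodrigoSadowski2016, Thm. 6.8 (proof, (6.6)-(6.10)) and Cor. 6.9] -/
theorem leray_enstrophy_apriori_holds : leray_enstrophy_apriori :=
  exists_leray_enstrophy_apriori

end Literature.Analysis.FluidPDE

end
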